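import Summits.PneNP.PneNP.Theses.NoTardosTropics
import Literature.Computability.Complexity.AdditiveRealClasses
import Literature.Computability.Complexity.FournierKoiranTransferOracle
import Literature.Computability.Complexity.OracleSubroutine
import Literature.Computability.Complexity.OracleOneQuery

/-!
# Route NoTardosTropics, item `OracleRemoval` (stmt-PneNP-2568): a `P` oracle is removable

Support item of the route `Summits/PneNP/PneNP/Theses/NoTardosTropics.lean`: if the Boolean
oracle `A` is in `P`, then every real language decided by a polynomial-time sign-query algorithm
WITH the tagged oracle `signOracleWith A x` (`true :: q ↦ [q ∈ A]`, `false :: q ↦` sign of the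
coded affine form at `x`) is decided by one WITHOUT it — `P⁰_add(A) ⊆ P⁰_add` for `A ∈ P`, the
"`P = NP ⇒` the oracle is removable" half of [Fournier–Koiran 2000, proof of Thm 1, p. 11].

Proof (all ingredients are in the tree's transcript model of oracle computation):

* the tagged oracle is computed FROM the sign oracle by the two-round one-query algorithm
  `OracleAlg.oneQuery D tl (χ_A ∘ tl) sndF` (`OracleOneQuery.lean`): on a query `u` with head bit
  `true` output `χ_A (tail u)` (the `P` decider, `indicatorFn_mem_FP`), otherwise ask the sign
  oracle `tail u` and return its answer;
* `OracleAlg.exists_polyTime_compose_local` (`OracleSubroutine.lean`) composes the given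
  machine with this inner algorithm into ONE polynomial-time sign-query algorithm;
* the query-length hypothesis of the composition theorem holds automatically because all
  answers are single bits, so a polynomial-time step function only emits polynomially long
  queries (`IsPolyTime.exists_length_le`, as in `FKPointLocation.exists_query_length_bound`).

The closing theorem `oracleRemoval_proof` has literally the type of the route decl; the named
form `PAddRel A ⊆ PAdd` (classes of `AdditiveRealClasses.lean`) is `PAddRel_subset_PAdd_of_mem_P`.
-/

set_option linter.dupNamespace false

namespace Summit.PneNP.PneNP.Theorems

open Computability Literature.Computability.Complexity

namespace NoTardosTropicsOracleRemoval

/-- Every answer of the tagged oracle `signOracleWith A x` is ONE bit. [folklore] -/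
theorem length_signOracleWith (A : Language Bool) {n : ℕ} (x : Fin n → ℝ) (w : List Bool) :
    (signOracleWith A x w).length = 1 := by
  rcases w with _ | ⟨b, w⟩
  · rfl
  · cases b <;> rfl

/-- **Queries of a polynomial-time sign-query algorithm are polynomially short**: on the input
`1ⁿ`, after any one-bit transcript of length `≤ q(n)`, the next query has length `≤ T(n)`.
[Fournier–Koiran 2000, §2 Remark 1; folklore in the transcript model] -/
theorem exists_query_length_bound (M : OracleAlg Bool) (hM : M.IsPolyTime encodingBoolBool)
    (q : Polynomial ℕ) :
    ∃ T : Polynomial ℕ, ∀ (n : ℕ) (ans : List (List Bool)), (∀ a ∈ ans, a.length = 1) →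
      ans.length ≤ q.eval n →
        ∀ qry, M.step (unaryEncodeNat n) ans = Sum.inl qry → qry.length ≤ T.eval n := by
  obtain ⟨R, hR⟩ := hM.exists_length_le
  refine ⟨R.comp (Polynomial.C 2 * Polynomial.X + Polynomial.C 6 * q + Polynomial.C 4),
    fun n ans hans hlen qry hq => ?_⟩
  have h := hR (unaryEncodeNat n) ans
  rw [hq] at h
  have hcode : (((encodingList Bool).sumBool encodingBoolBool).encode
      (Sum.inl qry : List Bool ⊕ Bool)).length = qry.length + 1 := by
    simp [Encoding.sumBool, encodingList]
  rw [hcode] at h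
  have hinput : (boolPair (unaryEncodeNat n) ((encodingList Bool).listBool.encode ans)).length ≤
      2 * n + 6 * q.eval n + 4 := by
    rw [length_boolPair, FKPointLocation.length_listBool_encode_oneBit ans hans,
      FKPointLocation.length_unaryEncodeNat']
    omega
  have := TM2Iter.eval_mono R hinput
  rw [Polynomial.eval_comp]
  simp only [Polynomial.eval_add, Polynomial.eval_mul, Polynomial.eval_C, Polynomial.eval_X]
  omega

/-- **The tagged oracle is two sign-query rounds away from the sign oracle** when `A ∈ P`: a
polynomial-time (string-output) oracle algorithm `N` with `N.run (signOracle x) (k+2) u =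
some (signOracleWith A x u)` for all `u` — answer `true :: q` by the `P` decider of `A`, forward
`false :: q` (and `ε`) to the sign oracle. [Fournier–Koiran 2000, proof of Thm 1 p. 11
("if P = NP the oracle can be simulated"); Arora–Barak 2009, §3.4] -/
theorem exists_inner (A : Language Bool) (hA : A ∈ Classes.P) :
    ∃ N : OracleAlg (List Bool), N.IsPolyTime (encodingList Bool) ∧
      ∀ (n : ℕ) (x : Fin n → ℝ) (u : List Bool) (k : ℕ),
        N.run (signOracle x) (k + 2) u = some (signOracleWith A x u) := by
  -- the tail of a string, as an `FP` brick
  obtain ⟨tl, htl, htl_eq⟩ : ∃ tl : List Bool → List Bool, tl ∈ FP ∧ ∀ w, tl w = w.tail :=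
    ⟨Plumb.dropFn ∘ fanoutFn (fun _ => [true]) id,
      comp_mem_FP Plumb.dropFn_mem_FP (fanoutFn_mem_FP (const_mem_FP _) (PolyTimeComputable.id _)),
      fun w => by simp⟩
  -- the `P` decider of `A`, as an `FP` brick
  obtain ⟨χ, hχ, hχ_eq⟩ : ∃ χ : List Bool → List Bool, χ ∈ FP ∧
      ∀ w, χ w = encodeBool (@decide (w ∈ A) (Classical.dec _)) := by
    refine ⟨fun w => encodeBool (A.boolIndicator w), indicatorFn_mem_FP hA, fun w => ?_⟩
    show encodeBool (A.boolIndicator w) = _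
    by_cases h : w ∈ A
    · rw [(Set.mem_iff_boolIndicator A w).1 h, @decide_eq_true _ (Classical.dec _) h]
    · rw [(Set.notMem_iff_boolIndicator A w).1 h, @decide_eq_false _ (Classical.dec _) h]
  -- the decision stage: "head bit is NOT `true`" (then the query is forwarded)
  have hD : ∀ w, Brick.notFn HashBricks.headBitFn w = [!(w.headD false)] := fun w =>
    Brick.notFn_apply (HashBricks.headBitFn_apply w)
  refine ⟨OracleAlg.oneQuery (Brick.notFn HashBricks.headBitFn) tl (χ ∘ tl) Brick.sndF,
    OracleAlg.isPolyTime_oneQuery _ _ _ _ (Brick.notFn_mem_FP HashBricks.headBitFn_mem_FP)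
      (fun w => ⟨_, hD w⟩) htl (comp_mem_FP hχ htl) Brick.sndF_mem_FP, fun n x u k => ?_⟩
  cases hu : u.headD false with
  | false =>
    -- forwarded: ask the sign oracle `tail u`, return its answer
    have hDu : Brick.notFn HashBricks.headBitFn u = [true] := by rw [hD u, hu]; rfl
    rw [OracleAlg.run_oneQuery_pos _ _ _ _ (signOracle x) hDu k, Brick.sndF_boolPair, htl_eq]
    simp only [signOracleWith, hu, cond_false]
  | true =>
    -- answered in-house by the `P` decider
    have hDu : Brick.notFn HashBricks.headBitFn u ≠ [true] := by rw [hD u, hu]; decide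
    rw [show k + 2 = (k + 1) + 1 from rfl,
      OracleAlg.run_oneQuery_neg _ _ _ _ (signOracle x) hDu (k + 1)]
    simp only [signOracleWith, hu, cond_true, Function.comp_apply, hχ_eq, htl_eq]

/-- **`P⁰_add(A) ⊆ P⁰_add` for `A ∈ P`** (named-class form of the item): a polynomial-time
sign-query algorithm with a `P` oracle on the tagged queries yields one without the oracle —
the composite machine answering each tagged query by the two-round inner algorithm of
`exists_inner` (`OracleAlg.exists_polyTime_compose_local`). [Fournier–Koiran 2000, proof of
Thm 1, p. 11; Ladner–Lynch–Selman 1975, §2; Baker–Gill–Solovay 1975, §1 (`P^P = P`)] -/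
theorem PAddRel_subset_PAdd_of_mem_P {A : Language Bool} (hA : A ∈ Classes.P) :
    PAddRel A ⊆ PAdd := by
  intro L hL
  obtain ⟨M, hM, q, hrun⟩ := hL
  obtain ⟨N, hN, hNrun⟩ := exists_inner A hA
  obtain ⟨T, hT⟩ := exists_query_length_bound M hM q
  obtain ⟨C, hC, qC, hcomp⟩ := OracleAlg.exists_polyTime_compose_local hM hN (q + T) (Polynomial.C 2)
  refine ⟨C, hC, qC, fun n x => ?_⟩
  have hlen : (unaryEncodeNat n).length = n := FKPointLocation.length_unaryEncodeNat' n
  have hqq : q.eval n ≤ (q + T).eval n := by simp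
  -- the given run, with the larger budget `(q + T)(n)`
  have hrun' : M.run (signOracleWith A x) ((q + T).eval (unaryEncodeNat n).length)
      (unaryEncodeNat n) = some (@decide (x ∈ L n) (Classical.dec _)) := by
    rw [hlen]; exact M.run_mono _ _ hqq (hrun n x)
  have h := hcomp (signOracle x) (signOracleWith A x) (unaryEncodeNat n) _ hrun' ?_ ?_
  · rw [hlen] at h; exact h.1
  · -- every query of the run is polynomially short (one-bit answers)
    intro y hy
    rw [hlen] at hy ⊢
    rw [M.queries_eq_of_run_eq_some _ _ hqq (hrun n x)] at hy
    obtain ⟨us, huslen, hstep, -, hus⟩ :=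
      M.exists_trace_of_runAux (signOracleWith A x) (unaryEncodeNat n) (q.eval n) [] _ (hrun n x)
    have hy' : y ∈ us := by rw [← hus]; exact hy
    obtain ⟨i, hi, rfl⟩ := List.getElem_of_mem hy'
    have hst := hstep i hi
    rw [List.nil_append] at hst
    have hb := hT n (((us.take i).map (signOracleWith A x))) (fun a ha => by
        obtain ⟨w, -, rfl⟩ := List.mem_map.1 ha
        exact length_signOracleWith A x w)
      (by simp only [List.length_map, List.length_take]; omega) _ hst
    exact hb.trans (by simp)
  · -- the inner algorithm answers every tagged query within `2` rounds
    intro u _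
    rw [Polynomial.eval_C]
    exact hNrun n x u 0

end NoTardosTropicsOracleRemoval

/-- **Item `OracleRemoval` of route NoTardosTropics (stmt-PneNP-2568), proved.** If `A ∈ P` then
a polynomial-time sign-query algorithm for a real language `L` with the tagged oracle
(`true :: q ↦ [q ∈ A]`, `false :: q ↦` sign of the coded form at `x`) yields one without the
Boolean oracle. The route decl is, after unfolding, `∀ A L, A ∈ Classes.P → L ∈ PAddRel A →
L ∈ PAdd` (`AdditiveRealClasses.lean`), which is
`NoTardosTropicsOracleRemoval.PAddRel_subset_PAdd_of_mem_P`. [Fournier–Koiran 2000, proof of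
Thm 1, p. 11] -/
theorem oracleRemoval_proof : Summit.PneNP.PneNP.Theses.NoTardosTropics.OracleRemoval := by
  intro A L hA hL
  exact NoTardosTropicsOracleRemoval.PAddRel_subset_PAdd_of_mem_P (A := A) hA (a := L) hL

end Summit.PneNP.PneNP.Theorems
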